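import Literature.Computability.Complexity.TimeBounds
import HarnessLib

/-!
# Polynomial-time decidable sets are closed under complement

Sibling proof file of `TimeBounds.lean` (D-0014: named facts `def X : Prop` are discharged as
`theorem X_holds : X`; this file contains theorems only). It discharges

* `Literature.CplxCore.PolyTimeDecidable.compl_holds : PolyTimeDecidable.compl` — if `L` is
  decidable in polynomial time (with respect to an encoder `ea`), then so is `Lᶜ`, i.e.
  "**P** is closed under complementation".

Source: S. Arora, B. Barak, *Computational Complexity: A Modern Approach*, CUP 2009:
§2.6.1 ("every language in **P** is in **NP** ∩ **coNP**", Exercise 2.23: "Prove that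
**P** ⊆ **NP** ∩ **coNP**"), and the sentence "**P** is closed under complementation" used in
the proof of Thm. 5.4. The printed argument is the one-liner "flip the answer": run the same
deterministic polynomial-time machine and output `1 - b` instead of `b`.

## Proof architecture

In Mathlib's bundled model (`Turing.TM2ComputableAux Γ₀ Bool`: a `FinTM2` together with
identifications `inputAlphabet : tm.Γ tm.k₀ ≃ Γ₀`, `outputAlphabet : tm.Γ tm.k₁ ≃ Bool`) no new
machine is needed to flip the answer: composing `outputAlphabet` with the negation
permutation of `Bool` makes the *same* run of the *same* transition table, ending in the *same*
halting configuration within the *same* number of steps, read as the negated bit.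

1. `Turing.TM2ComputableAux.OutputsWithin.outputAlphabet_trans`: relabelling the output
   alphabet along `e : Γ₁ ≃ Γ₂` turns an `OutputsWithin l l' m` into
   `OutputsWithin l (l'.map e) m` for the relabelled bundle (a deliberate dot-notation
   extension of Mathlib's `Turing.TM2ComputableAux`, like `OutputsWithin` itself).
2. `Literature.Computability.Complexity.boolIndicator_compl_apply`: `Lᶜ.boolIndicator a = !(L.boolIndicator a)`, so
   `encodeBool (Lᶜ.boolIndicator a) = (encodeBool (L.boolIndicator a)).map not`.
3. `Literature.Computability.Complexity.PolyTimeDecidable.compl_holds`: same polynomial `p`, relabelled machine;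
   `Literature.Computability.Complexity.polyTimeDecidable_compl_iff` is the corollary `Lᶜ ∈ P ↔ L ∈ P` (via `Lᶜᶜ = L`).

## References

* S. Arora, B. Barak, *Computational Complexity: A Modern Approach*, CUP 2009, §2.6.1,
  Exercise 2.23, proof of Thm. 5.4.
* M. Sipser, *Introduction to the Theory of Computation*, 3rd ed., Ch. 7 (P closed under
  complement, swap accept/reject states).
-/

namespace Turing.TM2ComputableAux

variable {Γ₀ Γ₁ Γ₂ : Type}

/-- Relabelling the output alphabet. If `M` maps `l` to `l'` within `m` steps, then the same
underlying machine, with its output alphabet identification composed with `e : Γ₁ ≃ Γ₂`,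
maps `l` to `l'.map e` within `m` steps (same run, same halting configuration). A deliberate
dot-notation extension of Mathlib's `Turing.TM2ComputableAux`. [folklore] -/
theorem OutputsWithin.outputAlphabet_trans {M : TM2ComputableAux Γ₀ Γ₁} {l : List Γ₀}
    {l' : List Γ₁} {m : ℕ} (h : M.OutputsWithin l l' m) (e : Γ₁ ≃ Γ₂) :
    OutputsWithin ⟨M.tm, M.inputAlphabet, M.outputAlphabet.trans e⟩ l (l'.map e) m := by
  have H : (l'.map e).map (M.outputAlphabet.trans e).symm = l'.map M.outputAlphabet.symm := by
    rw [List.map_map]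
    congr 1
    funext x
    simp
  show Nonempty (TM2OutputsInTime M.tm (l.map M.inputAlphabet.symm)
    (some ((l'.map e).map (M.outputAlphabet.trans e).symm)) m)
  rw [H]
  exact h

end Turing.TM2ComputableAux

namespace Literature.Computability.Complexity

open Turing _root_.Computability

variable {α Γ₀ : Type}

/-- The Boolean indicator of the complement is the negation of the Boolean indicator.
[folklore] -/
theorem boolIndicator_compl_apply (L : Set α) (a : α) :
    Lᶜ.boolIndicator a = !(L.boolIndicator a) := by
  by_cases ha : a ∈ L <;> simp [Set.boolIndicator, ha]

/-- **Discharge of `PolyTimeDecidable.compl`: polynomial-time decidable sets are closed under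
complement.** Given a machine `M` deciding `L` in time `p`, the machine
`⟨M.tm, M.inputAlphabet, M.outputAlphabet.trans not⟩` (same transition table, output alphabet
read through Boolean negation) decides `Lᶜ` in the same time `p`, because
`encodeBool (Lᶜ.boolIndicator a) = [!(L.boolIndicator a)]`. This is the "flip the answer"
argument: "every language in **P** is in **NP** ∩ **coNP**" [Arora–Barak 2009, §2.6.1 and
Exercise 2.23], "**P** is closed under complementation" [ibid., proof of Thm. 5.4].
[cite: AroraBarak2009, §2.6.1 and Exercise 2.23] -/
theorem PolyTimeDecidable.compl_holds : @PolyTimeDecidable.compl α Γ₀ := by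
  intro ea L h
  obtain ⟨p, M, hM⟩ := h
  obtain ⟨e, he⟩ : ∃ e : Bool ≃ Bool, ⇑e = not := ⟨⟨not, not, Bool.not_not, Bool.not_not⟩, rfl⟩
  refine ⟨p, ⟨M.tm, M.inputAlphabet, M.outputAlphabet.trans e⟩, fun a => ?_⟩
  have key : encodeBool (Lᶜ.boolIndicator a) = (encodeBool (L.boolIndicator a)).map e := by
    rw [he]
    change [Lᶜ.boolIndicator a] = [!(L.boolIndicator a)]
    rw [boolIndicator_compl_apply]
  change TM2ComputableAux.OutputsWithin _ (ea a) (encodeBool (Lᶜ.boolIndicator a)) _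
  rw [key]
  exact (hM a).outputAlphabet_trans e

/-- `L` is polynomial-time decidable iff its complement is (**P** = **coP**); both directions
are `PolyTimeDecidable.compl_holds`, using `Lᶜᶜ = L`.
[cite: AroraBarak2009, §2.6.1 and Exercise 2.23] -/
theorem polyTimeDecidable_compl_iff {ea : α → List Γ₀} {L : Set α} :
    PolyTimeDecidable ea Lᶜ ↔ PolyTimeDecidable ea L :=
  ⟨fun h => compl_compl L ▸ PolyTimeDecidable.compl_holds h,
    fun h => PolyTimeDecidable.compl_holds h⟩

end Literature.Computability.Complexity
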